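import Summits.BirchSwinnertonDyer.BirchSwinnertonDyer.Theorems.GenusKolyvaginAtTwoGenusPrimitiveSupplyAtTwoPosDiscShallowKFourPosLossless
import Summits.BirchSwinnertonDyer.BirchSwinnertonDyer.Theorems.GenusKolyvaginAtTwoKolyvaginExactAtTwoPosDiscT
import HarnessLib

/-!
# Route `GenusKolyvaginAtTwo`, crux K₄⁺ `K4Pos` (stmt-BirchSwinnertonDyer-31469) — THE KOLYVAGIN-FREE CURRENCY OF K₄⁺:
# on the Δ>0 cut, modulo Q2 and GZK, «K4Pos's conclusion» ⟺ «B₂ over `ℚ` is SHARP» ⟺ «a witness at ONE prime»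

Width seat `bsd-line-gk2-p5` g36 (cell `bsd-f1-sign2`), `--supports stmt-BirchSwinnertonDyer-31469 --as helper`.  THEOREMS ONLY (no definition,
no named fact, no `sorry`).  **BSD is NOT proved by this file; K4Pos is NOT proved; nothing is closed.**

The four statements below are EQUIVALENT at every point of K4Pos's frame that lies on the cut (an odd multiplicative prime), modulo Q2
(`KolyvaginRelationAtTwo`, = print 23091) and GZK (`MultPublishedInputsAtTwo`, used for `rank E(ℚ) = 0`):
 (a) a transposition-deep witness at ONE Kolyvagin prime `ℓ` (a datum of conductor `1·ℓ` with `P(ℓ) ∉ 2E(K[ℓ])`);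
 (b) K4Pos's conclusion (some square-free `n`);
 (c) EXACTNESS `#Ш(E/K)[2^∞] = 4^(M₀)`;
 (d) B₂ OVER `ℚ` IS SHARP: some `a ∈ Ш(E/ℚ)[2^∞]` has `2^(M₀−1) • a ≠ 0`.
(a)⟹(b) trivially; (b)⟹(c) is the landed exactness `Theorems.kolyvaginExactAtTwoPosDiscT_proof` (LEAD gk2-p1 / gk2-p2 / gk2-p3, R9_T); (c)⟹(d) is
§1 (g34's decoupled-exponent sandwich read contrapositively); (d)⟹(a) is this seat's halving descent B2Q♭.  So the beyond-print content of K₄⁺ is,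
in a currency with NO Kolyvagin prime and NO derived point, «`Ш(E/ℚ)[2^∞]` has exponent exactly `2^(M₀)`» (B₂ gives `≤`); and «`∃` square-free
`n`» in the crux text costs nothing over «`∃` prime `ℓ`» (LEAD-BRIEF-g22 §6 «K₄ (∃ square-free n) ⟺ K₄ at a SINGLE deep prime», there modulo
the structure theorem at `2` — here modulo Q2 + GZK only).  BSD is NOT proved by any of this.

References: [McCallumLMS1991] §5 Lemma 5.3, Thm. 5.4, Cor. 5.6; [Kolyvagin1989Izv] Thm. B₂; [Kramer1981] Thm. 1; [GrossLMS1991] §5 Prop. 5.3.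
-/

set_option autoImplicit false
-- the Theorems namespace of this sub repeats the summit name by design (D-0017 nested layout)
set_option linter.dupNamespace false

noncomputable section

open scoped Classical
open scoped AddSubgroup

namespace Summit.BirchSwinnertonDyer.BirchSwinnertonDyer.Theorems.GenusExact.PlusDescent

open WeierstrassCurve NumberField IsDedekindDomain Field Literature.NumberTheory.EllipticCurves
  Literature.NumberTheory.GaloisRepresentations Literature.NumberTheory.EllipticCurves.ModularForms AddSubgroup
  Literature.NumberTheory.EllipticCurves.RingClassField
open Summit.BirchSwinnertonDyer.BirchSwinnertonDyer.Theses.GenusKolyvaginAtTwo (KolyvaginRelationAtTwo MultPublishedInputsAtTwo)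
open Summit.BirchSwinnertonDyer.BirchSwinnertonDyer.Theorems.GenusSupplyNarrow

/-! ## §1 (c) ⟹ (d): exactness over `K` forces a class of order `2^{M₀}` in `Ш(E/ℚ)` -/

/-- **EXACTNESS ⟹ B₂ SHARP (sign-free, unconditional).**  On the frame of g34's decoupled-exponent sandwich
(`Lossless.natCard_primaryComponent_sha_baseChange_two_dvd_pow_of_shaExponent`: `E/ℚ` globally minimal, `C(E)` odd, `ρ̄₂` onto; `K` imaginary
quadratic, `d_K` odd, Heegner; `d₁` with `P(1)` of infinite order and `2^(M₀+1) ∤ P(1)`; `w(E) = +1`, `rank E(ℚ) = 0`; an elliptic twin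
`Wd ≅ E^(d_K)` with `#Sel₂(Wd) = 2` and the sign budget): if `#Ш(E/K)[2^∞] = 4^(M₀)` with `M₀ ≥ 1`, then some `2`-power-torsion class
`a ∈ Ш(E/ℚ)` has `2^(M₀−1) • a ≠ 0` — otherwise the sandwich would give `#Ш(E/K)[2^∞] ∣ 4^(M₀−1)`.  BSD is NOT proved by this.
[cite: Kramer1981, Thm. 1, §2 Prop. 3] [cite: GrossLMS1991, §5 Prop. 5.3] [cite: McCallumLMS1991, §5 Cor. 5.6] -/
theorem exists_mem_sha_two_pow_pred_smul_ne_zero_of_natCard_eq_pow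
    (W : WeierstrassCurve ℚ) [W.IsElliptic] [W.IsGloballyMinimal] [NeZero (W.conductorNorm ℤ)]
    (K : Type) [Field K] [NumberField K]
    (hT : Odd W.tamagawaProduct) (hIQ : IsImaginaryQuadratic K) (hodd : Odd (NumberField.discr K))
    (hHe : SatisfiesHeegnerHypothesis (W.conductorNorm ℤ) K) (hs2 : W.HasSurjectiveModNGaloisRep 2)
    (Dt : ModularParametrizationData W (W.conductorNorm ℤ)) (β : ℤ) (ι : K →+* ℂ) (d₁ : KolyvaginHeegnerData Dt β ι 1)
    (hy : ¬ IsOfFinAddOrder d₁.derivedPoint) (M₀ : ℕ) (hM₀ : 1 ≤ M₀)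
    (hndiv : ¬ ∃ Q : (W.baseChange (ringClassField K ι 1)).toAffine.Point, ((2 ^ (M₀ + 1) : ℕ) : ℤ) • Q = d₁.derivedPoint)
    (hw : W.rootNumber = 1) (hrk0 : W.mordellWeilRank = 0)
    (Wd : WeierstrassCurve ℚ) [Wd.IsElliptic] (hWd : ∃ C : VariableChange ℚ, C • W.quadraticTwist (NumberField.discr K : ℚ) = Wd)
    (hSel : Nat.card (Wd.selmerGroup 2) = 2)
    (hbudget : (W.Δ < 0 ∧ padicValNat 2 Wd.tamagawaProduct ≤ 1) ∨ (0 < W.Δ ∧ padicValNat 2 Wd.tamagawaProduct = 0))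
    (hexact : Nat.card (AddCommGroup.primaryComponent (W.baseChange K).sha 2) = 2 ^ (2 * M₀)) :
    ∃ (k : ℕ) (a : W.galH1), a ∈ W.sha ∧ ((2 ^ k : ℕ) : ℤ) • a = 0 ∧ ((2 ^ (M₀ - 1) : ℕ) : ℤ) • a ≠ 0 := by
  by_contra hno
  push Not at hno
  have hB2Q : ∀ (k : ℕ) (a : W.galH1), a ∈ W.sha → ((2 ^ k : ℕ) : ℤ) • a = 0 → ((2 ^ (M₀ - 1) : ℕ) : ℤ) • a = 0 :=
    fun k a ha hka ↦ hno k a ha hka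
  have hdvd := Lossless.natCard_primaryComponent_sha_baseChange_two_dvd_pow_of_shaExponent W K hT hIQ hodd hHe hs2 Dt β ι d₁ hy M₀ hndiv hw
    hrk0 Wd hWd hSel hbudget hB2Q
  rw [hexact] at hdvd
  have hle : 2 * M₀ ≤ 2 * (M₀ - 1) := (Nat.pow_dvd_pow_iff_le_right (by norm_num : 1 < 2)).mp hdvd
  omega

/-! ## §2 (b) ⟺ (d) on the Δ>0 cut; (b) ⟹ (a) -/

/-- **K4Pos's CONCLUSION ⟺ B₂ OVER `ℚ` IS SHARP** — on K4Pos's frame restricted to the cut (non-CM, `r_an = 0`, `ρ_{E,2^n}` onto, odd Tamagawa,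
`Δ > 0`, an odd multiplicative prime `v`; `K` frame with the two B₂ non-squares; `d₁` with `P(1)` of infinite order, `2^(M₀) ∥ P(1)`, `M₀ ≥ 1`; a
globally minimal twin `Wd ≅ E^(d_K)` with `#Sel₂(Wd) = 2`, `ord₂ C(Wd) = 0`), modulo Q2 and GZK (`rank = analytic rank`, for `rank E(ℚ) = 0`;
`w(E) = +1` from `r_an = 0` by the functional equation of the newform of `Dt`): **(∃ square-free `n`, a datum `d`, every `ℓ ∣ n` a
Zhang–Kolyvagin prime at `2` of index `≥ 2` with a Frobenius moving a point of `E[2]`, `P(n) ∉ 2E(K[n])) ⟺ (∃ `a ∈ Ш(E/ℚ)[2^∞]` with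
`2^(M₀−1) • a ≠ 0`)**.  (⟹) exactness `kolyvaginExactAtTwoPosDiscT_proof` + §1; (⟸) B2Q♭ (`kFourPos_shape_of_mem_sha_rat_of_two_pow_pred_smul_ne_zero`).
BSD is NOT proved by this; neither side is proved here. [cite: McCallumLMS1991, §5 Thm. 5.4, Cor. 5.6] [cite: Kolyvagin1989Izv, Thm. B₂] -/
theorem kFourPos_shape_iff_exists_mem_sha_two_pow_pred_smul_ne_zero (hQ2 : KolyvaginRelationAtTwo) (hGZK : MultPublishedInputsAtTwo)
    (W : WeierstrassCurve ℚ) [W.IsElliptic] [W.IsGloballyMinimal] [NeZero (W.conductorNorm ℤ)] (hcm : ¬ W.HasCM) (hr0 : W.analyticRank = 0)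
    (hρ : ∀ n : ℕ, 0 < n → W.HasSurjectiveModNGaloisRep ((2 : ℤ) ^ n)) (hT : Odd W.tamagawaProduct) (hΔ : 0 < W.Δ)
    (v : HeightOneSpectrum (𝓞 ℚ)) (h2v : ((2 : ℕ) : 𝓞 ℚ) ∉ v.asIdeal) (hNv : ((W.conductorNorm ℤ : ℕ) : 𝓞 ℚ) ∈ v.asIdeal)
    (hmult : W.HasMultiplicativeReductionAt v)
    (K : Type) [Field K] [NumberField K] (hIQ : IsImaginaryQuadratic K) (hodd : Odd (NumberField.discr K))
    (h3 : NumberField.discr K ≠ -3) (hHe : SatisfiesHeegnerHypothesis (W.conductorNorm ℤ) K)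
    (hsq1 : ¬ IsSquare ((NumberField.discr K : ℚ) * -|W.Δ|)) (hsq2 : ¬ IsSquare ((NumberField.discr K : ℚ) * (-(2 * |W.Δ|))))
    (Dt : ModularParametrizationData W (W.conductorNorm ℤ)) (β : ℤ) (ι : K →+* ℂ) (d₁ : KolyvaginHeegnerData Dt β ι 1)
    (hy : ¬ IsOfFinAddOrder d₁.derivedPoint) (M₀ : ℕ) (hM₀ : 1 ≤ M₀)
    (hdiv : ∃ Q : (W.baseChange (ringClassField K ι 1)).toAffine.Point, ((2 ^ M₀ : ℕ) : ℤ) • Q = d₁.derivedPoint)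
    (hndiv : ¬ ∃ Q : (W.baseChange (ringClassField K ι 1)).toAffine.Point, ((2 ^ (M₀ + 1) : ℕ) : ℤ) • Q = d₁.derivedPoint)
    (Wd : WeierstrassCurve ℚ) [Wd.IsElliptic] [Wd.IsGloballyMinimal]
    (hWd : ∃ C : VariableChange ℚ, C • W.quadraticTwist (NumberField.discr K : ℚ) = Wd)
    (hSel : Nat.card (Wd.selmerGroup 2) = 2) (hTam : padicValNat 2 Wd.tamagawaProduct = 0) :
    (∃ (n : ℕ) (d : KolyvaginHeegnerData Dt β ι n), Squarefree n ∧
      (∀ ℓ ∈ n.primeFactors, Zhang2014.IsKolyvaginPrime (W.conductorNorm ℤ) W K 2 ℓ ∧ 2 ≤ Zhang2014.kolyvaginIndex W 2 ℓ ∧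
        ∃ (v : HeightOneSpectrum (𝓞 ℚ)) (𝔓 : Ideal (absIntegers (𝓞 ℚ) ℚ)) (h : absoluteGaloisGroup ℚ),
          ((ℓ : ℕ) : 𝓞 ℚ) ∈ v.asIdeal ∧ 𝔓 ∈ v.primesAbove ∧ IsArithFrobAt (𝓞 ℚ) h 𝔓 ∧ ∃ u : W.geomTorsion ((2 : ℕ) : ℤ), h • u ≠ u) ∧
      ¬ ∃ Q : (W.baseChange (ringClassField K ι n)).toAffine.Point, (2 : ℤ) • Q = d.derivedPoint) ↔
    ∃ (k : ℕ) (a : W.galH1), a ∈ W.sha ∧ ((2 ^ k : ℕ) : ℤ) • a = 0 ∧ ((2 ^ (M₀ - 1) : ℕ) : ℤ) • a ≠ 0 := by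
  haveI : Fact (Nat.Prime 2) := ⟨Nat.prime_two⟩
  have hs2 : W.HasSurjectiveModNGaloisRep 2 := by simpa using hρ 1 one_pos
  have hw : W.rootNumber = 1 :=
    (Literature.Barriers.BirchSwinnertonDyer.even_analyticRank_iff_of_isNewformOf_conductorLevel Dt.isNewformOf).mp
      (by rw [hr0]; exact Even.zero)
  have hrk0 : W.mordellWeilRank = 0 := by rw [(hGZK W (by rw [hr0]; exact zero_le_one)).1, hr0]
  constructor
  · rintro ⟨n, d, hn, hprimes, hwit⟩
    -- (b) ⟹ (c): exactness on the Δ>0 cut (R9_T, landed)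
    have hexact : Nat.card (AddCommGroup.primaryComponent (W.baseChange K).sha 2) = 2 ^ (2 * M₀) :=
      Summit.BirchSwinnertonDyer.BirchSwinnertonDyer.Theorems.kolyvaginExactAtTwoPosDiscT_proof hQ2 W hcm hT v h2v hNv hmult hΔ K hIQ hodd h3
        hHe hsq1 hsq2 hρ Dt β ι d₁ hy M₀ hdiv hndiv hw Wd hWd hSel hTam n d hn hprimes hwit
    -- (c) ⟹ (d)
    exact exists_mem_sha_two_pow_pred_smul_ne_zero_of_natCard_eq_pow W K hT hIQ hodd hHe hs2 Dt β ι d₁ hy M₀ hM₀ hndiv hw hrk0 Wd hWd hSel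
      (Or.inr ⟨hΔ, hTam⟩) hexact
  · rintro ⟨k, a, ha, hka, hne⟩
    -- (d) ⟹ (b): the halving descent
    exact kFourPos_shape_of_mem_sha_rat_of_two_pow_pred_smul_ne_zero hQ2 W hcm hT v h2v hNv hmult K hIQ hodd h3 hHe hsq1 hsq2 hρ Dt β ι d₁ M₀
      hndiv hw k a ha hka hne

/-- **«∃ square-free `n`» COSTS NOTHING OVER «∃ prime `ℓ`»**: on the same frame (Δ>0 cut, modulo Q2 and GZK), a transposition-deep witness at
some square-free `n` yields a transposition-deep Kolyvagin prime `ℓ` (index `≥ 2`, an arithmetic Frobenius that is an involution of `E[2]` moving a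
point and acting on `K` as a complex conjugation) and a `d₁`-COMPATIBLE datum of conductor `1·ℓ` with `P(ℓ) ∉ 2E(K[ℓ])` — witness ⟹ exactness ⟹
B₂ sharp ⟹ (B2Q♭) prime-level witness.  (LEAD-BRIEF-g22 §6 «K₄ (∃ square-free n) ⟺ K₄ at a SINGLE deep prime» WITHOUT the structure theorem
at `2`.)  BSD is NOT proved by this. [cite: McCallumLMS1991, §5 Thm. 5.4, Cor. 5.6] [cite: Kolyvagin1989Izv, Thm. B₂] -/
theorem exists_prime_witness_of_squarefree_witness (hQ2 : KolyvaginRelationAtTwo) (hGZK : MultPublishedInputsAtTwo)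
    (W : WeierstrassCurve ℚ) [W.IsElliptic] [W.IsGloballyMinimal] [NeZero (W.conductorNorm ℤ)] (hcm : ¬ W.HasCM) (hr0 : W.analyticRank = 0)
    (hρ : ∀ n : ℕ, 0 < n → W.HasSurjectiveModNGaloisRep ((2 : ℤ) ^ n)) (hT : Odd W.tamagawaProduct) (hΔ : 0 < W.Δ)
    (v : HeightOneSpectrum (𝓞 ℚ)) (h2v : ((2 : ℕ) : 𝓞 ℚ) ∉ v.asIdeal) (hNv : ((W.conductorNorm ℤ : ℕ) : 𝓞 ℚ) ∈ v.asIdeal)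
    (hmult : W.HasMultiplicativeReductionAt v)
    (K : Type) [Field K] [NumberField K] (hIQ : IsImaginaryQuadratic K) (hodd : Odd (NumberField.discr K))
    (h3 : NumberField.discr K ≠ -3) (hHe : SatisfiesHeegnerHypothesis (W.conductorNorm ℤ) K)
    (hsq1 : ¬ IsSquare ((NumberField.discr K : ℚ) * -|W.Δ|)) (hsq2 : ¬ IsSquare ((NumberField.discr K : ℚ) * (-(2 * |W.Δ|))))
    (Dt : ModularParametrizationData W (W.conductorNorm ℤ)) (β : ℤ) (ι : K →+* ℂ) (d₁ : KolyvaginHeegnerData Dt β ι 1)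
    (hy : ¬ IsOfFinAddOrder d₁.derivedPoint) (M₀ : ℕ) (hM₀ : 1 ≤ M₀)
    (hdiv : ∃ Q : (W.baseChange (ringClassField K ι 1)).toAffine.Point, ((2 ^ M₀ : ℕ) : ℤ) • Q = d₁.derivedPoint)
    (hndiv : ¬ ∃ Q : (W.baseChange (ringClassField K ι 1)).toAffine.Point, ((2 ^ (M₀ + 1) : ℕ) : ℤ) • Q = d₁.derivedPoint)
    (Wd : WeierstrassCurve ℚ) [Wd.IsElliptic] [Wd.IsGloballyMinimal]
    (hWd : ∃ C : VariableChange ℚ, C • W.quadraticTwist (NumberField.discr K : ℚ) = Wd)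
    (hSel : Nat.card (Wd.selmerGroup 2) = 2) (hTam : padicValNat 2 Wd.tamagawaProduct = 0)
    {n : ℕ} (d : KolyvaginHeegnerData Dt β ι n) (hn : Squarefree n)
    (hprimes : ∀ ℓ ∈ n.primeFactors, Zhang2014.IsKolyvaginPrime (W.conductorNorm ℤ) W K 2 ℓ ∧ 2 ≤ Zhang2014.kolyvaginIndex W 2 ℓ ∧
        ∃ (v : HeightOneSpectrum (𝓞 ℚ)) (𝔓 : Ideal (absIntegers (𝓞 ℚ) ℚ)) (h : absoluteGaloisGroup ℚ),
          ((ℓ : ℕ) : 𝓞 ℚ) ∈ v.asIdeal ∧ 𝔓 ∈ v.primesAbove ∧ IsArithFrobAt (𝓞 ℚ) h 𝔓 ∧ ∃ u : W.geomTorsion ((2 : ℕ) : ℤ), h • u ≠ u)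
    (hwit : ¬ ∃ Q : (W.baseChange (ringClassField K ι n)).toAffine.Point, (2 : ℤ) • Q = d.derivedPoint) :
    ∃ (ℓ : ℕ) (d' : KolyvaginHeegnerData Dt β ι (1 * ℓ)),
      Zhang2014.IsKolyvaginPrime (W.conductorNorm ℤ) W K 2 ℓ ∧ 2 ≤ Zhang2014.kolyvaginIndex W 2 ℓ ∧
      (∃ (v : HeightOneSpectrum (𝓞 ℚ)) (𝔓 : Ideal (absIntegers (𝓞 ℚ) ℚ)) (h c₀ : absoluteGaloisGroup ℚ),
          (ℓ : 𝓞 ℚ) ∈ v.asIdeal ∧ 𝔓 ∈ v.primesAbove ∧ IsArithFrobAt (𝓞 ℚ) h 𝔓 ∧ IsComplexConjugation (Rat.castHom ℝ) c₀ ∧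
          (∀ X : geomTorsion W ((2 : ℕ) : ℤ), h • h • X = X) ∧
          (∃ u : geomTorsion W ((2 : ℕ) : ℤ), h • u ≠ u) ∧
          ∀ (e : K →ₐ[ℚ] AlgebraicClosure ℚ) (z : K), h • e z = c₀ • e z) ∧
      (∀ s ∈ d₁.S, ∃ s' ∈ d'.S, ∀ (x : ringClassField K ι 1) (x' : ringClassField K ι (1 * ℓ)),
          (x : ℂ) = x' → ((s' x' : ringClassField K ι (1 * ℓ)) : ℂ) = (s x : ℂ)) ∧
      (∀ (x : ringClassField K ι 1) (x' : ringClassField K ι (1 * ℓ)), (x : ℂ) = x' → d'.emb x' = d₁.emb x) ∧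
      ¬ ∃ Q : (W.baseChange (ringClassField K ι (1 * ℓ))).toAffine.Point, (2 : ℤ) • Q = d'.derivedPoint := by
  haveI : Fact (Nat.Prime 2) := ⟨Nat.prime_two⟩
  have hs2 : W.HasSurjectiveModNGaloisRep 2 := by simpa using hρ 1 one_pos
  have hw : W.rootNumber = 1 :=
    (Literature.Barriers.BirchSwinnertonDyer.even_analyticRank_iff_of_isNewformOf_conductorLevel Dt.isNewformOf).mp
      (by rw [hr0]; exact Even.zero)
  have hrk0 : W.mordellWeilRank = 0 := by rw [(hGZK W (by rw [hr0]; exact zero_le_one)).1, hr0]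
  have hexact : Nat.card (AddCommGroup.primaryComponent (W.baseChange K).sha 2) = 2 ^ (2 * M₀) :=
    Summit.BirchSwinnertonDyer.BirchSwinnertonDyer.Theorems.kolyvaginExactAtTwoPosDiscT_proof hQ2 W hcm hT v h2v hNv hmult hΔ K hIQ hodd h3
      hHe hsq1 hsq2 hρ Dt β ι d₁ hy M₀ hdiv hndiv hw Wd hWd hSel hTam n d hn hprimes hwit
  obtain ⟨k, a, ha, hka, hne⟩ := exists_mem_sha_two_pow_pred_smul_ne_zero_of_natCard_eq_pow W K hT hIQ hodd hHe hs2 Dt β ι d₁ hy M₀ hM₀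
    hndiv hw hrk0 Wd hWd hSel (Or.inr ⟨hΔ, hTam⟩) hexact
  -- lift `a` to a Selmer class and run B2Q♭
  rcases Nat.eq_zero_or_pos k with rfl | hkpos
  · rw [pow_zero, Nat.cast_one, one_zsmul] at hka
    exact (hne (by rw [hka, zsmul_zero])).elim
  · have hnz : ((2 ^ k : ℕ) : ℤ) ≠ 0 := by positivity
    have hmem : a ∈ W.sha ⊓ torsionBy W.galH1 ((2 ^ k : ℕ) : ℤ) :=
      AddSubgroup.mem_inf.mpr ⟨ha, by change ((2 ^ k : ℕ) : ℤ) • a = 0; exact hka⟩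
    rw [← WeierstrassCurve.map_torsionH1ToH1_selmerGroup_holds W hnz] at hmem
    obtain ⟨x, hx, rfl⟩ := AddSubgroup.mem_map.mp hmem
    have hne' : ((2 ^ (M₀ - 1) : ℕ) : ℤ) • x ≠ 0 := fun h ↦ hne (by rw [← map_zsmul, h, map_zero])
    exact exists_transpositionDeep_primitive_of_two_pow_pred_smul_ne_zero hQ2 W hcm hT v h2v hNv hmult K hIQ hodd h3 hHe hsq1 hsq2 hρ Dt β ι d₁
      M₀ hndiv hw k x hx hne'

/-! ## §3 The per-curve certificate: a class of order `2^{M₀}` at level `2^{M₀}` (depth two: `Sel₄(E/ℚ)` has a class of order `4`) -/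

/-- **PER-CURVE CERTIFICATE FORM.**  On K4Pos's cut frame (modulo Q2): a class `t ∈ Sel_(2^{M₀})(E/ℚ)` with `2^{M₀−1} • t ≠ 0` — i.e. of order
exactly `2^{M₀}`; at DEPTH TWO (`M₀ = 2`, the case BSD predicts on every WALL-row-1 cell with `16 ∥ #Ш_an`) a class of ORDER `4` in
`Sel₄(E/ℚ)`, decidable per curve by a `4`-descent — yields K4Pos's conclusion for that curve and frame.  (Instrument for `-data` / the
planner: on census cells, `2^{M₀}`-descent lower bounds on `Ш(E/ℚ)` are K₄-certificates; class-wide this is the `2`-part of BSD in rank `0`.)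
BSD is NOT proved by this; K4Pos is NOT proved by this. [cite: McCallumLMS1991, §5 Thm. 5.4] [cite: Kolyvagin1989Izv, Thm. B₂] -/
theorem kFourPos_shape_of_selmer_class_of_order_two_pow_depth (hQ2 : KolyvaginRelationAtTwo)
    (W : WeierstrassCurve ℚ) [W.IsElliptic] [W.IsGloballyMinimal] [NeZero (W.conductorNorm ℤ)] (hcm : ¬ W.HasCM) (hr0 : W.analyticRank = 0)
    (hρ : ∀ n : ℕ, 0 < n → W.HasSurjectiveModNGaloisRep ((2 : ℤ) ^ n)) (hT : Odd W.tamagawaProduct)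
    (v : HeightOneSpectrum (𝓞 ℚ)) (h2v : ((2 : ℕ) : 𝓞 ℚ) ∉ v.asIdeal) (hNv : ((W.conductorNorm ℤ : ℕ) : 𝓞 ℚ) ∈ v.asIdeal)
    (hmult : W.HasMultiplicativeReductionAt v)
    (K : Type) [Field K] [NumberField K] (hIQ : IsImaginaryQuadratic K) (hodd : Odd (NumberField.discr K))
    (h3 : NumberField.discr K ≠ -3) (hHe : SatisfiesHeegnerHypothesis (W.conductorNorm ℤ) K)
    (hsq1 : ¬ IsSquare ((NumberField.discr K : ℚ) * -|W.Δ|)) (hsq2 : ¬ IsSquare ((NumberField.discr K : ℚ) * (-(2 * |W.Δ|))))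
    (Dt : ModularParametrizationData W (W.conductorNorm ℤ)) (β : ℤ) (ι : K →+* ℂ) (d₁ : KolyvaginHeegnerData Dt β ι 1) (M₀ : ℕ)
    (hndiv : ¬ ∃ Q : (W.baseChange (ringClassField K ι 1)).toAffine.Point, ((2 ^ (M₀ + 1) : ℕ) : ℤ) • Q = d₁.derivedPoint)
    (t : galH1Torsion W ((2 ^ M₀ : ℕ) : ℤ)) (ht : t ∈ selmerGroup W ((2 ^ M₀ : ℕ) : ℤ)) (hord : ((2 ^ (M₀ - 1) : ℕ) : ℤ) • t ≠ 0) :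
    ∃ (n : ℕ) (d : KolyvaginHeegnerData Dt β ι n), Squarefree n ∧
      (∀ ℓ ∈ n.primeFactors, Zhang2014.IsKolyvaginPrime (W.conductorNorm ℤ) W K 2 ℓ ∧ 2 ≤ Zhang2014.kolyvaginIndex W 2 ℓ ∧
        ∃ (v : HeightOneSpectrum (𝓞 ℚ)) (𝔓 : Ideal (absIntegers (𝓞 ℚ) ℚ)) (h : absoluteGaloisGroup ℚ),
          ((ℓ : ℕ) : 𝓞 ℚ) ∈ v.asIdeal ∧ 𝔓 ∈ v.primesAbove ∧ IsArithFrobAt (𝓞 ℚ) h 𝔓 ∧ ∃ u : W.geomTorsion ((2 : ℕ) : ℤ), h • u ≠ u) ∧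
      ¬ ∃ Q : (W.baseChange (ringClassField K ι n)).toAffine.Point, (2 : ℤ) • Q = d.derivedPoint := by
  have hw : W.rootNumber = 1 :=
    (Literature.Barriers.BirchSwinnertonDyer.even_analyticRank_iff_of_isNewformOf_conductorLevel Dt.isNewformOf).mp
      (by rw [hr0]; exact Even.zero)
  exact kFourPos_shape_of_two_pow_pred_smul_ne_zero hQ2 W hcm hT v h2v hNv hmult K hIQ hodd h3 hHe hsq1 hsq2 hρ Dt β ι d₁ M₀ hndiv hw
    ⟨M₀, t, ht, hord⟩

/-! ## §4 The cost of a K₄-failure: Kolyvagin's bound over `K` drops by a factor `4` -/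

/-- **NO PRIME-LEVEL WITNESS ⟹ `#Ш(E/K)[2^∞] ∣ 4^(M₀−1)`** (sign-free; cut frame, modulo Q2 and GZK).  If the conclusion of K4Pos / K4Neg FAILS
at a supply frame on the cut (no square-free `n` of transposition-deep Kolyvagin primes with `P(n) ∉ 2E(K[n])`), then B2Q♭ gives
`2^(M₀−1) · Ш(E/ℚ)[2^∞] = 0` and g34's decoupled-exponent sandwich gives `#Ш(E/K)[2^∞] ∣ 4^(M₀−1)` — one factor `4` BELOW Kolyvagin's bound
`4^(M₀)` (U_T / U⁺_T) and below the Gross–Zagier–BSD value.  The dichotomy for cdisprove / the planner: at every cut frame, EITHER K₄ holds OR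
`Ш(E/K)[2^∞]` is at least `4` times smaller than BSD predicts.  BSD is NOT proved by this. [cite: McCallumLMS1991, §5 Thm. 5.4, Cor. 5.6]
[cite: Kramer1981, Thm. 1] [cite: GrossLMS1991, §5 Prop. 5.3] -/
theorem natCard_primaryComponent_sha_baseChange_dvd_pow_pred_of_not_kFourPos_shape (hQ2 : KolyvaginRelationAtTwo)
    (hGZK : MultPublishedInputsAtTwo)
    (W : WeierstrassCurve ℚ) [W.IsElliptic] [W.IsGloballyMinimal] [NeZero (W.conductorNorm ℤ)] (hcm : ¬ W.HasCM) (hr0 : W.analyticRank = 0)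
    (hρ : ∀ n : ℕ, 0 < n → W.HasSurjectiveModNGaloisRep ((2 : ℤ) ^ n)) (hT : Odd W.tamagawaProduct)
    (v : HeightOneSpectrum (𝓞 ℚ)) (h2v : ((2 : ℕ) : 𝓞 ℚ) ∉ v.asIdeal) (hNv : ((W.conductorNorm ℤ : ℕ) : 𝓞 ℚ) ∈ v.asIdeal)
    (hmult : W.HasMultiplicativeReductionAt v)
    (K : Type) [Field K] [NumberField K] (hIQ : IsImaginaryQuadratic K) (hodd : Odd (NumberField.discr K))
    (h3 : NumberField.discr K ≠ -3) (hHe : SatisfiesHeegnerHypothesis (W.conductorNorm ℤ) K)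
    (hsq1 : ¬ IsSquare ((NumberField.discr K : ℚ) * -|W.Δ|)) (hsq2 : ¬ IsSquare ((NumberField.discr K : ℚ) * (-(2 * |W.Δ|))))
    (Dt : ModularParametrizationData W (W.conductorNorm ℤ)) (β : ℤ) (ι : K →+* ℂ) (d₁ : KolyvaginHeegnerData Dt β ι 1)
    (hy : ¬ IsOfFinAddOrder d₁.derivedPoint) (M₀ : ℕ)
    (hndiv : ¬ ∃ Q : (W.baseChange (ringClassField K ι 1)).toAffine.Point, ((2 ^ (M₀ + 1) : ℕ) : ℤ) • Q = d₁.derivedPoint)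
    (Wd : WeierstrassCurve ℚ) [Wd.IsElliptic] (hWd : ∃ C : VariableChange ℚ, C • W.quadraticTwist (NumberField.discr K : ℚ) = Wd)
    (hSel : Nat.card (Wd.selmerGroup 2) = 2)
    (hbudget : (W.Δ < 0 ∧ padicValNat 2 Wd.tamagawaProduct ≤ 1) ∨ (0 < W.Δ ∧ padicValNat 2 Wd.tamagawaProduct = 0))
    (hno : ¬ ∃ (n : ℕ) (d : KolyvaginHeegnerData Dt β ι n), Squarefree n ∧
      (∀ ℓ ∈ n.primeFactors, Zhang2014.IsKolyvaginPrime (W.conductorNorm ℤ) W K 2 ℓ ∧ 2 ≤ Zhang2014.kolyvaginIndex W 2 ℓ ∧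
        ∃ (v : HeightOneSpectrum (𝓞 ℚ)) (𝔓 : Ideal (absIntegers (𝓞 ℚ) ℚ)) (h : absoluteGaloisGroup ℚ),
          ((ℓ : ℕ) : 𝓞 ℚ) ∈ v.asIdeal ∧ 𝔓 ∈ v.primesAbove ∧ IsArithFrobAt (𝓞 ℚ) h 𝔓 ∧ ∃ u : W.geomTorsion ((2 : ℕ) : ℤ), h • u ≠ u) ∧
      ¬ ∃ Q : (W.baseChange (ringClassField K ι n)).toAffine.Point, (2 : ℤ) • Q = d.derivedPoint) :
    Nat.card (AddCommGroup.primaryComponent (W.baseChange K).sha 2) ∣ 2 ^ (2 * (M₀ - 1)) := by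
  haveI : Fact (Nat.Prime 2) := ⟨Nat.prime_two⟩
  have hs2 : W.HasSurjectiveModNGaloisRep 2 := by simpa using hρ 1 one_pos
  have hw : W.rootNumber = 1 :=
    (Literature.Barriers.BirchSwinnertonDyer.even_analyticRank_iff_of_isNewformOf_conductorLevel Dt.isNewformOf).mp
      (by rw [hr0]; exact Even.zero)
  have hrk0 : W.mordellWeilRank = 0 := by rw [(hGZK W (by rw [hr0]; exact zero_le_one)).1, hr0]
  have hB2Q : ∀ (k : ℕ) (a : W.galH1), a ∈ W.sha → ((2 ^ k : ℕ) : ℤ) • a = 0 → ((2 ^ (M₀ - 1) : ℕ) : ℤ) • a = 0 := by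
    intro k a ha hka
    by_contra hne
    exact hno (kFourPos_shape_of_mem_sha_rat_of_two_pow_pred_smul_ne_zero hQ2 W hcm hT v h2v hNv hmult K hIQ hodd h3 hHe hsq1 hsq2 hρ Dt β
      ι d₁ M₀ hndiv hw k a ha hka hne)
  exact Lossless.natCard_primaryComponent_sha_baseChange_two_dvd_pow_of_shaExponent W K hT hIQ hodd hHe hs2 Dt β ι d₁ hy M₀ hndiv hw hrk0 Wd
    hWd hSel hbudget hB2Q

end Summit.BirchSwinnertonDyer.BirchSwinnertonDyer.Theorems.GenusExact.PlusDescent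

end
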